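import Literature.AlgebraicGeometry.Resolution.PolygonInvariantsIndexed
import HarnessLib

/-!
# (K-Φ2) chain dictionary V: the polygon is FUNCTORIAL under ring isomorphisms (frame and ideal transported together)

Cell `res-dim4-pi` (D-0157 DOOR 2), Φ = β_h line of res-dim4-idea-1 (CARD I-1-8). Two places of the chain dictionary change the presentation of
the SAME local ring by an isomorphism: (a) reading the residual in the coordinates of a carried LINEAR frame (a linear automorphism of
`K[x]`, hence of `𝒪 = K[x]_{𝔪₀}`), and (b) the «j ≠ h, t_h ≠ 0» LOSE-h edges (crit-4 Q(P2-j); crit-2 g3: 0 of 3,779 bed rows, but a proof must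
cover them), where the tree's `x_j`-chart and CJS's `u₁`-chart are two charts at the same point related by the transition isomorphism. This
file proves, for EVERY commutative ring and index type, that Hironaka's Newton point set and all scaled polygon invariants of
`PolygonInvariantsIndexed` are unchanged when the frame `c` and the ideal `J` are moved by the same ring isomorphism `e : R ≃+* R′`
(DEF-FREE):

* `weightedOrderIdeal_map_ringEquiv` (`F_ρ(e ∘ c) = e(F_ρ(c))`), `isInitialTerm_ringEquiv_iff` (initial unit terms correspond:
  representative `map e F`), `occ_ringEquiv`, **`pts_ringEquiv`** (`pts (e ∘ c) (J.map e) μ = pts c J μ`);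
* hence `deltaS_ringEquiv`, `alphaS_ringEquiv`, `betaS_ringEquiv`, `epsS_ringEquiv`, `zetaS_ringEquiv`, `gammaMinusS_ringEquiv`,
  `gammaPlusS_ringEquiv`, and `span_range_ringEquiv_comp` (the transported frame generates the transported ideal).

[OURS · counted 0 · AI work weaker than expert review.] Nothing here proves K2(p), the β_h line, or resolution of singularities in dimension ≥ 4 /
characteristic p.

Sources: V. Cossart, U. Jannsen, S. Saito, LNM **2270** (2020), Def. 8.2 («`Δ(g, y, u)` does not depend on the presentation»), Def. 11.1
[`CossartJannsenSaito2020`]; H. Hironaka, J. Math. Kyoto Univ. 7 (1967) §1 [`Hironaka1967`].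
-/

noncomputable section

open IsLocalRing MvPolynomial
open Literature.AlgebraicGeometry.Resolution (cmonom weightedOrderIdeal eval_monomial_eq_cmonom)
open Literature.AlgebraicGeometry.Resolution.WeightedOrder

set_option linter.dupNamespace false

namespace Summit.ResolutionOfSingularities.ResolutionOfSingularities.Theorems.PIDim4.PhiLine

universe u v

section RingEquiv

variable {R R' : Type u} [CommRing R] [CommRing R'] {σ : Type v} (e : R ≃+* R') (c : σ → R)

/-- Monomials of the transported frame: `(e ∘ c)^m = e(c^m)`. [cite: CossartJannsenSaito2020, (7.3)] -/
theorem cmonom_ringEquiv_comp (m : σ →₀ ℕ) : cmonom (e ∘ c) m = e (cmonom c m) := by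
  classical
  unfold cmonom
  rw [Finsupp.prod, Finsupp.prod, map_prod]
  refine Finset.prod_congr rfl fun i _ => ?_
  rw [Function.comp_apply, map_pow]

/-- **Weighted order ideals are transported**: `F_ρ(e ∘ c) = e(F_ρ(c))`. [cite: CossartJannsenSaito2020, Def. 7.2 (1)] -/
theorem weightedOrderIdeal_map_ringEquiv (w : σ → ℕ) (ρ : ℕ) :
    weightedOrderIdeal (e ∘ c) w ρ = (weightedOrderIdeal c w ρ).map (e : R →+* R') := by
  unfold weightedOrderIdeal
  rw [Ideal.map_span]
  congr 1
  ext x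
  constructor
  · rintro ⟨m, hm, rfl⟩
    exact ⟨cmonom c m, ⟨m, hm, rfl⟩, (cmonom_ringEquiv_comp e c m).symm⟩
  · rintro ⟨_, ⟨m, hm, rfl⟩, rfl⟩
    exact ⟨m, hm, (cmonom_ringEquiv_comp e c m).symm⟩

/-- Evaluation at the transported frame: `(map e F)(e ∘ c) = e(F(c))`. [folklore] -/
theorem eval_comp_map_ringEquiv (F : MvPolynomial σ R) : eval (e ∘ c) (MvPolynomial.map (e : R →+* R') F) = e (eval c F) := by
  rw [eval_map, MvPolynomial.eval, coe_eval₂Hom]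
  change _ = (e : R →+* R') (eval₂ (RingHom.id R) c F)
  rw [eval₂_comp_left]
  rfl

/-- **Initial unit terms correspond** under a ring isomorphism moving frame and element together. [cite: CossartJannsenSaito2020, Def. 8.2] -/
theorem isInitialTerm_ringEquiv_iff (w : σ → ℕ) (f : R) (m : σ →₀ ℕ) :
    IsInitialTerm (e ∘ c) w (e f) m ↔ IsInitialTerm c w f m := by
  classical
  constructor
  · rintro ⟨F, hF, hFu, hrem⟩
    refine ⟨MvPolynomial.map (e.symm : R' →+* R) F, ?_, ?_, ?_⟩
    · intro d hd
      rw [coeff_map] at hd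
      exact hF (fun h0 => hd (by rw [h0, map_zero]))
    · rw [coeff_map]; exact (hFu.map (e.symm : R' →+* R))
    · have h1 : e.symm (e f - eval (e ∘ c) F) ∈ (weightedOrderIdeal (e ∘ c) w (Finsupp.weight w m + 1)).map (e.symm : R' →+* R) :=
        Ideal.mem_map_of_mem _ hrem
      rw [weightedOrderIdeal_map_ringEquiv, Ideal.map_map] at h1
      have hid : ((e.symm : R' →+* R).comp (e : R →+* R')) = RingHom.id R := by
        ext x; simp
      rw [hid, Ideal.map_id] at h1
      have hev : e.symm (eval (e ∘ c) F) = eval c (MvPolynomial.map (e.symm : R' →+* R) F) := by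
        have := eval_comp_map_ringEquiv e.symm (e ∘ c) F
        have hcomp : (e.symm ∘ (e ∘ c) : σ → R) = c := by funext i; simp
        rw [hcomp] at this
        exact this.symm
      rwa [map_sub, RingEquiv.symm_apply_apply, hev] at h1
  · rintro ⟨F, hF, hFu, hrem⟩
    refine ⟨MvPolynomial.map (e : R →+* R') F, ?_, ?_, ?_⟩
    · intro d hd
      rw [coeff_map] at hd
      exact hF (fun h0 => hd (by rw [h0, map_zero]))
    · rw [coeff_map]; exact hFu.map (e : R →+* R')
    · rw [eval_comp_map_ringEquiv, ← map_sub, weightedOrderIdeal_map_ringEquiv]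
      exact Ideal.mem_map_of_mem _ hrem

/-- **Newton point sets correspond**: `occ (e ∘ c) (J.map e) = occ c J`. [cite: CossartJannsenSaito2020, Def. 8.2] -/
theorem occ_ringEquiv (J : Ideal R) : occ (e ∘ c) (J.map (e : R →+* R')) = occ c J := by
  ext m
  constructor
  · rintro ⟨f', hf', w, hw, hinit⟩
    rw [Ideal.mem_map_iff_of_surjective (e : R →+* R') e.surjective] at hf'
    obtain ⟨f, hf, rfl⟩ := hf'
    exact ⟨f, hf, w, hw, (isInitialTerm_ringEquiv_iff e c w f m).mp hinit⟩
  · rintro ⟨f, hf, w, hw, hinit⟩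
    exact ⟨e f, Ideal.mem_map_of_mem _ hf, w, hw, (isInitialTerm_ringEquiv_iff e c w f m).mpr hinit⟩

end RingEquiv

section Polygon

variable {R R' : Type u} [CommRing R] [CommRing R'] {r : ℕ} (e : R ≃+* R') (c : Fin (r + 2) → R) (J : Ideal R) (μ : ℕ)

/-- **The polygon's point set is presentation-independent under ring isomorphisms**: `pts (e ∘ c) (J.map e) μ = pts c J μ`.
[cite: CossartJannsenSaito2020, Def. 8.2] -/
theorem pts_ringEquiv : pts (e ∘ c) (J.map (e : R →+* R')) μ = pts c J μ := by
  ext m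
  simp only [pts, Set.mem_setOf_eq, occ_ringEquiv]

/-- `δ` is presentation-independent. [cite: CossartJannsenSaito2020, Def. 11.1] -/
theorem deltaS_ringEquiv : deltaS (e ∘ c) (J.map (e : R →+* R')) μ = deltaS c J μ := by
  unfold deltaS; rw [pts_ringEquiv]

/-- `α` is presentation-independent. [cite: CossartJannsenSaito2020, Def. 11.1] -/
theorem alphaS_ringEquiv : alphaS (e ∘ c) (J.map (e : R →+* R')) μ = alphaS c J μ := by
  unfold alphaS; rw [pts_ringEquiv]

/-- `β` is presentation-independent. [cite: CossartJannsenSaito2020, Def. 11.1] -/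
theorem betaS_ringEquiv : betaS (e ∘ c) (J.map (e : R →+* R')) μ = betaS c J μ := by
  unfold betaS; rw [pts_ringEquiv, alphaS_ringEquiv]

/-- `ε` is presentation-independent. [cite: CossartJannsenSaito2020, Def. 11.1] -/
theorem epsS_ringEquiv : epsS (e ∘ c) (J.map (e : R →+* R')) μ = epsS c J μ := by
  unfold epsS; rw [pts_ringEquiv]

/-- `ζ` is presentation-independent. [cite: CossartJannsenSaito2020, Def. 11.1] -/
theorem zetaS_ringEquiv : zetaS (e ∘ c) (J.map (e : R →+* R')) μ = zetaS c J μ := by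
  unfold zetaS; rw [pts_ringEquiv, epsS_ringEquiv]

/-- `γ⁻` is presentation-independent. [cite: CossartJannsenSaito2020, Def. 11.1] -/
theorem gammaMinusS_ringEquiv : gammaMinusS (e ∘ c) (J.map (e : R →+* R')) μ = gammaMinusS c J μ := by
  unfold gammaMinusS; rw [pts_ringEquiv, deltaS_ringEquiv]

/-- `γ⁺` is presentation-independent. [cite: CossartJannsenSaito2020, Def. 11.1] -/
theorem gammaPlusS_ringEquiv : gammaPlusS (e ∘ c) (J.map (e : R →+* R')) μ = gammaPlusS c J μ := by
  unfold gammaPlusS; rw [pts_ringEquiv, deltaS_ringEquiv]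

/-- The transported frame generates the transported ideal (`hgen` transfers). [folklore] -/
theorem span_range_ringEquiv_comp : Ideal.span (Set.range (e ∘ c)) = (Ideal.span (Set.range c)).map (e : R →+* R') := by
  rw [Ideal.map_span, Set.range_comp]
  rfl

/-- A principal ideal is transported to the principal ideal of the image. [folklore] -/
theorem map_span_singleton_ringEquiv (g : R) : (Ideal.span {g}).map (e : R →+* R') = Ideal.span {e g} := by
  rw [Ideal.map_span, Set.image_singleton]
  rfl

end Polygon

end Summit.ResolutionOfSingularities.ResolutionOfSingularities.Theorems.PIDim4.PhiLine

end
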